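import Literature.NumberTheory.Transcendental.GammaLocusRegular
import Literature.NumberTheory.Transcendental.GammaIsoAlgebraicStep
import Literature.FieldTheory.Regular.RegularBaseChange
import Literature.RingTheory.KrullDimension.FieldOfDefinition
import HarnessLib

/-!
# The `K`-locus `W = Loc((c/M!, b)/K)` over the transported locus: strong rotundity

Toolkit for Bays–Kirby 2018, Prop. 11.2 (`Literature.NumberTheory.Transcendental.BaysKirby2018_prop_11_2`; M. Bays, J. Kirby,
*Pseudo-exponential maps, variants, and quasiminimality*, Algebra & Number Theory 12 (2018),
Def. 11.1, Prop. 11.2, proof of Thm 11.6).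

In the application of generic strong Γ-closedness over `K` (Def. 11.1,
`GammaField.IsGenericallyStronglyGammaClosedOver`) to `W₀ = Z(P')_F`, the transported locus of
a good basis `b` along a Γ-isomorphism `θ : ⟨K c⟩ ≅ ⟨K c'⟩` (`GammaLocusRegular.lean`), with
`α = (a', exp a')`, `a' = c'/M!`, one needs the `K`-locus
`W = Loc(α, V/K) = Z(I_{K₀}({α} × V))`, `V = W₀ ∩ Gⁿ` (`locOver`), to be **strongly rotund**. We
identify its ideal: `I_{K₀}({α} × V) = I((c/M!, b, exp (c/M!), exp b)/K₀)` is the ideal over `K₀`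
of the honest point on the *source* side (`GammaField.mem_vanishingIdeal_image_prodPt_iff`: `θ`
fixes `K₀`, substituting `α` commutes with `θ`, and `P'·F[X] ∩ ⟨K c'⟩[X] = P'` by faithful
flatness, `Literature.FieldTheory.Regular.map_mem_map_iff`). Since `K` is Γ-closed, every proper
finitely generated extension of `K` has predimension `≥ 1` (Def. 4.9), so for `M ≠ 0` some
`rk M + 1` coordinates of `[M](c/M!, b, exp(c/M!), exp b)` are algebraically independent over
`K₀` (`GammaField.exists_algebraicIndependent_matrixAct_of_isGammaClosed`); transporting to a
component of `W` (`LocusComponents.lean`) gives `dim [M]·W > rk M`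
(`GammaField.isStronglyRotund_locOver`). We also record the elementary facts about
`a' = c'/M!` used there (`linIndepOver_div_factorial`, `span_range_div_factorial`).

## References

* M. Bays, J. Kirby, *Pseudo-exponential maps, variants, and quasiminimality*, Algebra & Number
  Theory 12 (2018) 493–549: Def. 4.9, Prop. 7.3 (proof), Def. 11.1, Prop. 11.2, Thm 11.6 (proof).
-/

noncomputable section

open Set MvPolynomial

universe u

namespace Literature.NumberTheory.Transcendental

namespace GammaField

open Literature.ModelTheory.ExponentialFields.ExponentialRing ZilberSaturationMain
  Literature.FieldTheory.Regular

attribute [local instance] MvPolynomial.algebraMvPolynomial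

variable {F : Type u} [Field F] [CharZero F] [Literature.ModelTheory.ExponentialFields.ExponentialRing F]
variable {K : Submodule ℚ F} {N n : ℕ}

/-! ### Elementary facts about `c/M!` -/

omit [Literature.ModelTheory.ExponentialFields.ExponentialRing F] in
/-- `ℚ(c/M!) = ℚc`. [folklore] -/
theorem span_range_div_factorial (c : Fin N → F) (M : ℕ) :
    Submodule.span ℚ (range fun i => c i / (M.factorial : F)) = Submodule.span ℚ (range c) := by
  have hM : ((M.factorial : ℕ) : ℚ) ≠ 0 := Nat.cast_ne_zero.2 M.factorial_ne_zero
  refine le_antisymm (Submodule.span_le.2 ?_) (Submodule.span_le.2 ?_)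
  · rintro _ ⟨i, rfl⟩
    show c i / (M.factorial : F) ∈ _
    rw [div_natCast_eq_smul]
    exact Submodule.smul_mem _ _ (Submodule.subset_span ⟨i, rfl⟩)
  · rintro _ ⟨i, rfl⟩
    show c i ∈ _
    have : c i = ((M.factorial : ℕ) : ℚ) • (c i / (M.factorial : F)) := by
      rw [div_natCast_eq_smul, smul_smul, mul_inv_cancel₀ hM, one_smul]
    rw [this]
    exact Submodule.smul_mem _ _ (Submodule.subset_span ⟨i, rfl⟩)

omit [Literature.ModelTheory.ExponentialFields.ExponentialRing F] in
/-- `c/M!` is linearly independent over `Λ` when `c` is. [folklore] -/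
theorem linIndepOver_div_factorial {Λ : Submodule ℚ F} {c : Fin N → F} (hc : LinIndepOver Λ c)
    (M : ℕ) : LinIndepOver Λ fun i => c i / (M.factorial : F) := by
  have hM : ((M.factorial : ℕ) : ℚ)⁻¹ ≠ 0 := inv_ne_zero (Nat.cast_ne_zero.2 M.factorial_ne_zero)
  have := hc.smul hM
  convert this using 2 with i
  rw [div_natCast_eq_smul]

/-! ### Rotundity data over a Γ-closed `K` -/

/-- **`rk M + 1` algebraically independent coordinates over `K₀` for `M ≠ 0`.** If `K` is
Γ-closed and `x` is linearly independent over `K`, then for every non-zero integer matrix `M`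
some `rk M + 1` coordinates of `[M](x, exp x)` are algebraically independent over `K₀`: the rows
of `M x` span, modulo `K`, a space of dimension `rk M` whose predimension over the Γ-closed `K` is
`≥ 1` (Def. 4.9), so `td ≥ rk M + 1`. [cite: BaysKirby2018ANT, Def. 4.9, Prop. 7.3 (proof)] -/
theorem exists_algebraicIndependent_matrixAct_of_isGammaClosed (hK : IsGammaClosed K) {m : ℕ}
    {x : Fin m → F} (hx : LinIndepOver K x) (M : Matrix (Fin m) (Fin m) ℤ) (hM : M ≠ 0) :
    ∃ s : Fin ((M.map (Int.cast : ℤ → ℚ)).rank + 1) → Fin m ⊕ Fin m,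
      AlgebraicIndependent (fieldOf K) fun i => matrixAct M (gammaPt x) (s i) := by
  classical
  let w : Fin m → F := fun i => ∑ j, (M i j : F) * x j
  have hfg : IsFG K (Submodule.span ℚ (range w)) := isFG_span_of_finite K (finite_range w)
  -- some row is non-zero, so `K + ℚw ≠ K`
  obtain ⟨i₀, j₀, hij⟩ : ∃ i j, M i j ≠ 0 := by
    by_contra h
    push Not at h
    exact hM (Matrix.ext h)
  have hwi : w i₀ ∉ K := by
    have h1 := hx.sum_intCast_smul_notMem (m := fun j => M i₀ j)
      (fun h0 => hij (by simpa using congrFun h0 j₀))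
    have h2 : w i₀ = ∑ j, ((M i₀ j : ℤ) : ℚ) • x j := by
      refine Finset.sum_congr rfl fun j _ => ?_
      rw [Rat.smul_def, Rat.cast_intCast]
    rw [h2]
    exact h1
  have hne : K ⊔ Submodule.span ℚ (range w) ≠ K := fun h =>
    hwi (h ▸ Submodule.mem_sup_right (Submodule.subset_span ⟨i₀, rfl⟩))
  have hδ : 1 ≤ predim K (Submodule.span ℚ (range w)) := by
    have := hK.one_le_predim le_sup_left (isFG_sup_left.2 hfg) hne
    rwa [predim_sup_left] at this
  have hldim : ldim K (Submodule.span ℚ (range w)) = (M.map (Int.cast : ℤ → ℚ)).rank :=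
    ldim_span_rows_eq_rank hx M
  have htd : (((M.map (Int.cast : ℤ → ℚ)).rank + 1 : ℕ) : ℕ∞) ≤ td K (Submodule.span ℚ (range w)) := by
    rw [predim_def, hldim] at hδ
    have h1 : (M.map (Int.cast : ℤ → ℚ)).rank + 1 ≤ (td K (Submodule.span ℚ (range w))).toNat := by
      omega
    rw [← ENat.coe_toNat (td_ne_top hfg)]
    exact_mod_cast h1
  have hrel : (((M.map (Int.cast : ℤ → ℚ)).rank + 1 : ℕ) : ℕ∞) ≤ (algMatroid F).relRank
      ((fieldOf K : IntermediateField ℚ F) : Set F) (range (matrixAct M (gammaPt x))) := by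
    rw [(algMatroid F).relRank_congr_closure_left _ (acl_fieldOf K), matrixAct_gammaPt, range_gammaPt]
    exact htd.trans (td_span_le_relRank K (range w))
  obtain ⟨s, hs⟩ := exists_algebraicIndependent_of_le_relRank (fieldOf K) (matrixAct M (gammaPt x)) hrel
  exact ⟨s, hs⟩

/-! ### The ideal over `K₀` of `{α} × V` is the ideal of the honest source point -/

/-- `c/M!` and `exp (c/M!)` lie in `⟨K c⟩`. [folklore] -/
theorem div_factorial_mem_bfld (c : Fin N → F) (M : ℕ) (i : Fin N) :
    c i / (M.factorial : F) ∈ bfld K c ∧ exp (c i / (M.factorial : F)) ∈ bfld K c := by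
  constructor
  · exact mem_adjoinField_of_mem_sup (div_factorial_mem_sup_span K c M i)
  · simpa only [lvGens_inr] using lvGens_mem_adjoinField (K := K) M c (Sum.inr i)

omit [CharZero F] in
/-- `((a, exp a), (g, exp g)) = ((a, g), exp (a, g))`. [folklore] -/
theorem prodPt_gammaPt_eq {r : ℕ} (a : Fin r → F) (g : Fin n → F) :
    prodPt (gammaPt a) (gammaPt g) = gammaPt (Fin.append a g) := by
  funext j
  rcases j with (i | i)
  · simp only [prodPt_inl, gammaPt_inl]; rfl
  · simp only [prodPt_inr, gammaPt_inr]
    refine Fin.addCases (fun i => ?_) (fun i => ?_) i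
    · simp [gammaPt]
    · simp [gammaPt]

/-- `θ(c/M!) = c'/M!` and `θ(exp (c/M!)) = exp (c'/M!)`. [folklore] -/
theorem coe_fieldEquiv_div_factorial {c c' : Fin N → F} (hiso : IsGammaIso K c c') (M : ℕ) (i : Fin N) :
    (hiso.fieldEquiv ⟨c i / (M.factorial : F), (div_factorial_mem_bfld c M i).1⟩ : F) =
        c' i / (M.factorial : F) ∧
      (hiso.fieldEquiv ⟨exp (c i / (M.factorial : F)), (div_factorial_mem_bfld c M i).2⟩ : F) =
        exp (c' i / (M.factorial : F)) := by
  constructor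
  · rw [hiso.coe_fieldEquiv_eq_transport (div_factorial_mem_sup_span K c M i), div_natCast_eq_smul,
      hiso.transport_smul _ (Submodule.mem_sup_right (Submodule.subset_span ⟨i, rfl⟩)),
      hiso.transport_apply, div_natCast_eq_smul]
  · have := hiso.coe_fieldEquiv_lvGens M (Sum.inr i)
    simpa only [lvGens_inr] using this

/-- **The ideal over `K₀` of `{(a', exp a')} × (Z(P')_F ∩ Gⁿ)`, `a' = c'/M!`, is the ideal of the
point `(c/M!, b, exp (c/M!), exp b)` over `K₀`** (for `P'·F[X]` prime and `Z(P')_F` meeting the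
torus): a polynomial over `K₀` vanishes on `{α'} × V` iff its `α'`-substitution (over `⟨K c'⟩`)
lies in `P'·F[X] ∩ ⟨K c'⟩[X] = P'` (faithful flatness), iff — applying `θ⁻¹`, which fixes `K₀`
and sends `α'` to `α = (c/M!, exp (c/M!))` — its `α`-substitution lies in `P = I((b, exp b)/⟨K c⟩)`,
iff it vanishes at `(α, b, exp b)`. [cite: BaysKirby2018ANT, Def. 11.1, Thm 11.6 (proof)] -/
theorem mem_vanishingIdeal_image_prodPt_iff [IsAlgClosed F] {c c' : Fin N → F}
    (hiso : IsGammaIso K c c') (b : Fin n → F) (M : ℕ)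
    [hprime : ((locusIdeal' K hiso b).map (algebraMap (MvPolynomial (Fin n ⊕ Fin n) (bfld K c'))
      (MvPolynomial (Fin n ⊕ Fin n) F))).IsPrime]
    (hne : (zeroLocus F ((locusIdeal' K hiso b).map (algebraMap (MvPolynomial (Fin n ⊕ Fin n) (bfld K c'))
      (MvPolynomial (Fin n ⊕ Fin n) F))) ∩ torusLocus F n).Nonempty)
    (p : MvPolynomial (Fin (N + n) ⊕ Fin (N + n)) (fieldOf K).toSubfield) :
    p ∈ MvPolynomial.vanishingIdeal (fieldOf K).toSubfield
        (prodPt (gammaPt fun i => c' i / (M.factorial : F)) ''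
          (zeroLocus F ((locusIdeal' K hiso b).map (algebraMap (MvPolynomial (Fin n ⊕ Fin n) (bfld K c'))
            (MvPolynomial (Fin n ⊕ Fin n) F))) ∩ torusLocus F n)) ↔
      aeval (gammaPt (Fin.append (fun i => c i / (M.factorial : F)) b)) p = 0 := by
  classical
  -- the inclusions `K₀ → ⟨K c⟩`, `K₀ → ⟨K c'⟩`
  let ι₀ : (fieldOf K).toSubfield →+* bfld K c :=
    { toFun := fun x => ⟨x, (bfld K c).algebraMap_mem ⟨x, x.2⟩⟩
      map_one' := Subtype.ext rfl
      map_mul' := fun _ _ => Subtype.ext rfl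
      map_zero' := Subtype.ext rfl
      map_add' := fun _ _ => Subtype.ext rfl }
  let ι₀' : (fieldOf K).toSubfield →+* bfld K c' :=
    { toFun := fun x => ⟨x, (bfld K c').algebraMap_mem ⟨x, x.2⟩⟩
      map_one' := Subtype.ext rfl
      map_mul' := fun _ _ => Subtype.ext rfl
      map_zero' := Subtype.ext rfl
      map_add' := fun _ _ => Subtype.ext rfl }
  have hι₀ : ∀ x, ((ι₀ x : bfld K c) : F) = x := fun _ => rfl
  have hι₀' : ∀ x, ((ι₀' x : bfld K c') : F) = x := fun _ => rfl
  have hθι : ∀ x, hiso.fieldEquiv (ι₀ x) = ι₀' x := fun x =>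
    Subtype.ext (by rw [hι₀']; exact hiso.coe_fieldEquiv_algebraMap ⟨x, x.2⟩)
  -- the substitutions of `α = (c/M!, exp (c/M!))` and `α' = (c'/M!, exp (c'/M!))`
  let w : Fin (N + n) ⊕ Fin (N + n) → MvPolynomial (Fin n ⊕ Fin n) (bfld K c) :=
    Sum.elim (Fin.addCases (fun i => C ⟨c i / (M.factorial : F), (div_factorial_mem_bfld c M i).1⟩)
        fun j => X (Sum.inl j))
      (Fin.addCases (fun i => C ⟨exp (c i / (M.factorial : F)), (div_factorial_mem_bfld c M i).2⟩)
        fun j => X (Sum.inr j))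
  let w' : Fin (N + n) ⊕ Fin (N + n) → MvPolynomial (Fin n ⊕ Fin n) (bfld K c') :=
    Sum.elim (Fin.addCases (fun i => C ⟨c' i / (M.factorial : F), (div_factorial_mem_bfld c' M i).1⟩)
        fun j => X (Sum.inl j))
      (Fin.addCases (fun i => C ⟨exp (c' i / (M.factorial : F)), (div_factorial_mem_bfld c' M i).2⟩)
        fun j => X (Sum.inr j))
  have hθw : ∀ j, MvPolynomial.map (hiso.fieldEquiv : bfld K c →+* bfld K c') (w j) = w' j := by
    rintro (j | j)
    · refine Fin.addCases (fun i => ?_) (fun i => ?_) j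
      · simp only [w, w', Sum.elim_inl, Fin.addCases_left, map_C]
        congr 1
        exact Subtype.ext (coe_fieldEquiv_div_factorial hiso M i).1
      · simp only [w, w', Sum.elim_inl, Fin.addCases_right, map_X]
    · refine Fin.addCases (fun i => ?_) (fun i => ?_) j
      · simp only [w, w', Sum.elim_inr, Fin.addCases_left, map_C]
        congr 1
        exact Subtype.ext (coe_fieldEquiv_div_factorial hiso M i).2
      · simp only [w, w', Sum.elim_inr, Fin.addCases_right, map_X]
  have hθp : MvPolynomial.map (hiso.fieldEquiv : bfld K c →+* bfld K c') (eval₂ (C.comp ι₀) w p) =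
      eval₂ (C.comp ι₀') w' p := by
    rw [eval₂_comp_left]
    congr 1
    · ext x
      simp only [RingHom.coe_comp, Function.comp_apply, map_C]
      rw [show (hiso.fieldEquiv : bfld K c →+* bfld K c') (ι₀ x) = hiso.fieldEquiv (ι₀ x) from rfl, hθι]
    · funext j
      exact hθw j
  -- evaluating the substituted polynomials
  have hevalα' : ∀ v : Fin n ⊕ Fin n → F,
      aeval v (eval₂ (C.comp ι₀') w' p) = aeval (prodPt (gammaPt fun i => c' i / (M.factorial : F)) v) p := by
    intro v
    rw [show aeval v (eval₂ (C.comp ι₀') w' p) = (aeval v).toRingHom (eval₂ (C.comp ι₀') w' p) from rfl,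
      eval₂_comp_left, aeval_def]
    congr 1
    · ext x
      simp only [RingHom.coe_comp, Function.comp_apply, AlgHom.toRingHom_eq_coe, AlgHom.coe_toRingHom,
        aeval_C]
      rw [IntermediateField.algebraMap_apply]
      rfl
    · funext j
      rcases j with j | j
      · refine Fin.addCases (fun i => ?_) (fun i => ?_) j
        · simp only [w', Function.comp_apply, Sum.elim_inl, Fin.addCases_left, AlgHom.toRingHom_eq_coe,
            AlgHom.coe_toRingHom, aeval_C, prodPt_inl, Fin.append_left, gammaPt_inl]
          rw [IntermediateField.algebraMap_apply]
        · simp [w']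
      · refine Fin.addCases (fun i => ?_) (fun i => ?_) j
        · simp only [w', Function.comp_apply, Sum.elim_inr, Fin.addCases_left, AlgHom.toRingHom_eq_coe,
            AlgHom.coe_toRingHom, aeval_C, prodPt_inr, Fin.append_left, gammaPt_inr]
          rw [IntermediateField.algebraMap_apply]
        · simp [w']
  have hevalα : aeval (gammaPt b) (eval₂ (C.comp ι₀) w p) =
      aeval (gammaPt (Fin.append (fun i => c i / (M.factorial : F)) b)) p := by
    rw [← prodPt_gammaPt_eq, show aeval (gammaPt b) (eval₂ (C.comp ι₀) w p) =
      (aeval (gammaPt b)).toRingHom (eval₂ (C.comp ι₀) w p) from rfl, eval₂_comp_left, aeval_def]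
    congr 1
    · ext x
      simp only [RingHom.coe_comp, Function.comp_apply, AlgHom.toRingHom_eq_coe, AlgHom.coe_toRingHom,
        aeval_C]
      rw [IntermediateField.algebraMap_apply]
      rfl
    · funext j
      rcases j with j | j
      · refine Fin.addCases (fun i => ?_) (fun i => ?_) j
        · simp only [w, Function.comp_apply, Sum.elim_inl, Fin.addCases_left, AlgHom.toRingHom_eq_coe,
            AlgHom.coe_toRingHom, aeval_C, prodPt_inl, Fin.append_left, gammaPt_inl]
          rw [IntermediateField.algebraMap_apply]
        · simp [w]
      · refine Fin.addCases (fun i => ?_) (fun i => ?_) j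
        · simp only [w, Function.comp_apply, Sum.elim_inr, Fin.addCases_left, AlgHom.toRingHom_eq_coe,
            AlgHom.coe_toRingHom, aeval_C, prodPt_inr, Fin.append_left, gammaPt_inr]
          rw [IntermediateField.algebraMap_apply]
        · simp [w]
  -- the chain of equivalences
  rw [mem_vanishingIdeal_iff]
  have key : (∀ x ∈ prodPt (gammaPt fun i => c' i / (M.factorial : F)) ''
      (zeroLocus F ((locusIdeal' K hiso b).map (algebraMap (MvPolynomial (Fin n ⊕ Fin n) (bfld K c'))
        (MvPolynomial (Fin n ⊕ Fin n) F))) ∩ torusLocus F n), aeval x p = 0) ↔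
      MvPolynomial.map (algebraMap (bfld K c') F) (eval₂ (C.comp ι₀') w' p) ∈
        vanishingIdeal F (zeroLocus F ((locusIdeal' K hiso b).map (algebraMap
          (MvPolynomial (Fin n ⊕ Fin n) (bfld K c')) (MvPolynomial (Fin n ⊕ Fin n) F))) ∩ torusLocus F n) := by
    rw [mem_vanishingIdeal_iff]
    constructor
    · intro h v hv
      rw [aeval_map_algebraMap, hevalα']
      exact h _ ⟨v, hv, rfl⟩
    · rintro h _ ⟨v, hv, rfl⟩
      rw [← hevalα', ← aeval_map_algebraMap F (x := v) (eval₂ (C.comp ι₀') w' p)]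
      exact h v hv
  rw [key, vanishingIdeal_zeroLocus_inter_torusLocus _ hne, MvPolynomial.algebraMap_def, map_mem_map_iff,
    mem_locusIdeal'_iff, ← hθp, MvPolynomial.map_map,
    RingEquiv.symm_comp, MvPolynomial.map_id, hevalα]

/-! ### Strong rotundity of `W = Loc(α', V/K)` -/

/-- **`W = Loc(α', (Z(P')_F ∩ Gⁿ)/K) ∩ G^{N+n}` is strongly rotund** when `K` is Γ-closed and
`(c/M!, b)` is linearly independent over `K` (B–K, proof of Thm 11.6: "`W` is strongly rotund
since `K` is Γ-closed in `F`"): `W ⊇ Z(Q_c)` for a component `Q_c` of the base change of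
`I((c/M!, b, exp(c/M!), exp b)/K₀)` (`mem_vanishingIdeal_image_prodPt_iff`), and `rk M + 1`
coordinates of `[M]` of that point are algebraically independent over `K₀` for `M ≠ 0`
(`exists_algebraicIndependent_matrixAct_of_isGammaClosed`), which transport to the component
(`LocusComponents.algebraicIndependent_funcMap`). [cite: BaysKirby2018ANT, Thm 11.6 (proof), Prop. 7.3 (proof)] -/
theorem isStronglyRotund_locOver [IsAlgClosed F] (hK : IsGammaClosed K) {c c' : Fin N → F}
    (hiso : IsGammaIso K c c') (b : Fin n → F) (M : ℕ)
    [hprime : ((locusIdeal' K hiso b).map (algebraMap (MvPolynomial (Fin n ⊕ Fin n) (bfld K c'))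
      (MvPolynomial (Fin n ⊕ Fin n) F))).IsPrime]
    (hne : (zeroLocus F ((locusIdeal' K hiso b).map (algebraMap (MvPolynomial (Fin n ⊕ Fin n) (bfld K c'))
      (MvPolynomial (Fin n ⊕ Fin n) F))) ∩ torusLocus F n).Nonempty)
    (hlin : LinIndepOver K (Fin.append (fun i => c i / (M.factorial : F)) b)) :
    IsStronglyRotund F (N + n)
      (locOver K (gammaPt fun i => c' i / (M.factorial : F))
        (zeroLocus F ((locusIdeal' K hiso b).map (algebraMap (MvPolynomial (Fin n ⊕ Fin n) (bfld K c'))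
          (MvPolynomial (Fin n ⊕ Fin n) F))) ∩ torusLocus F n) ∩ torusLocus F (N + n)) := by
  classical
  intro M' hM'
  -- the ideal over `K₀` of `{α'} × V` and its honest generic point `(c/M!, b, exp(c/M!), exp b)`
  let Q₀ : Ideal (MvPolynomial (Fin (N + n) ⊕ Fin (N + n)) (fieldOf K).toSubfield) :=
    MvPolynomial.vanishingIdeal (fieldOf K).toSubfield
      (prodPt (gammaPt fun i => c' i / (M.factorial : F)) ''
        (zeroLocus F ((locusIdeal' K hiso b).map (algebraMap (MvPolynomial (Fin n ⊕ Fin n) (bfld K c'))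
          (MvPolynomial (Fin n ⊕ Fin n) F))) ∩ torusLocus F n))
  have hW : locOver K (gammaPt fun i => c' i / (M.factorial : F))
      (zeroLocus F ((locusIdeal' K hiso b).map (algebraMap (MvPolynomial (Fin n ⊕ Fin n) (bfld K c'))
        (MvPolynomial (Fin n ⊕ Fin n) F))) ∩ torusLocus F n) = zeroLocus F Q₀ := rfl
  have hgen : IsGenericPt Q₀ (gammaPt (Fin.append (fun i => c i / (M.factorial : F)) b)) := fun q =>
    (mem_vanishingIdeal_image_prodPt_iff hiso b M hne q).symm
  haveI hQ₀ : Q₀.IsPrime := by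
    rw [← (isGenericPt_iff_ker_eq Q₀ _).1 hgen]
    exact RingHom.ker_isPrime _
  obtain ⟨Qc, hQc⟩ := LocusComponents.exists_mem_minimalPrimes_map
    (k := (fieldOf K).toSubfield) (F := F) (P := Q₀)
  haveI : Qc.IsPrime := hQc.1.1
  have hY : ∀ i, (X (Sum.inr i) : MvPolynomial (Fin (N + n) ⊕ Fin (N + n)) (fieldOf K).toSubfield) ∉ Q₀ :=
    fun i => (LocusComponents.X_inr_notMem_iff Q₀ hgen i).2 (by rw [gammaPt_inr]; exact exp_ne_zero _)
  have hnec := LocusComponents.component_inter_torusLocus_nonempty hQc hY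
  -- `rk M' + 1` algebraically independent coordinates, transported to the component
  obtain ⟨s, hs⟩ := exists_algebraicIndependent_matrixAct_of_isGammaClosed hK hlin M' hM'
  have hs' : AlgebraicIndependent (fieldOf K).toSubfield
      fun i => matrixAct M' (gammaPt (Fin.append (fun i => c i / (M.factorial : F)) b)) (s i) := hs
  have h1 := LocusComponents.algebraicIndependent_matrixAct_genericPt Q₀ hgen M' s hs'
  have h2 := LocusComponents.algebraicIndependent_funcMap hQc h1
  have h3 : (LocusComponents.funcMap hQc) ∘ (fun i => matrixAct M' (genericPt Q₀) (s i)) =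
      fun i => matrixAct M' (genericPt Qc) (s i) := by
    funext i
    simp only [Function.comp_apply]
    rw [← LocusComponents.funcMap_comp_genericPt hQc, ← LocusComponents.map_matrixAct]
    rfl
  rw [h3] at h2
  have h4 := le_zariskiDim_image_matrixAct' Qc (isGenericPt_genericPt Qc) hnec M' (fun i => X (s i))
    (by simpa only [aeval_X] using h2)
  have h5 : matrixAct M' '' (zeroLocus F Qc ∩ torusLocus F (N + n)) ⊆
      matrixAct M' '' (locOver K (gammaPt fun i => c' i / (M.factorial : F))
        (zeroLocus F ((locusIdeal' K hiso b).map (algebraMap (MvPolynomial (Fin n ⊕ Fin n) (bfld K c'))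
          (MvPolynomial (Fin n ⊕ Fin n) F))) ∩ torusLocus F n) ∩ torusLocus F (N + n)) := by
    rw [hW]
    exact Set.image_mono (inter_subset_inter_left _ (LocusComponents.zeroLocus_subset_zeroLocus hQc))
  calc ((M'.map (Int.cast : ℤ → ℚ)).rank : WithBot ℕ∞)
      < (((M'.map (Int.cast : ℤ → ℚ)).rank + 1 : ℕ) : WithBot ℕ∞) := by
        exact_mod_cast Nat.lt_succ_self _
    _ ≤ zariskiDim F (matrixAct M' '' (zeroLocus F Qc ∩ torusLocus F (N + n))) := h4
    _ ≤ _ := zariskiDim_mono h5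

/-! ### `Z(P')_F` is defined over `K(c'/M!, exp (c'/M!))` for large `M` -/

/-- Level-`m` generators of `c'` lie in `K(c'/M!, exp(c'/M!))` for `m ≤ M`. [folklore] -/
theorem lvGens_mem_adjoinPt_div_factorial (c' : Fin N → F) {m M : ℕ} (h : m ≤ M) (j : Fin N ⊕ Fin N) :
    lvGens m c' j ∈ adjoinPt K fun i => c' i / (M.factorial : F) := by
  rcases j with i | i
  · rw [lvGens_inl]
    have hM : ((M.factorial : ℕ) : F) ≠ 0 := Nat.cast_ne_zero.2 M.factorial_ne_zero
    have : c' i = (M.factorial : F) * (c' i / (M.factorial : F)) := by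
      rw [mul_div_cancel₀ _ hM]
    rw [this]
    exact mul_mem (natCast_mem _ _) (gammaPt_mem_adjoinPt K (fun i => c' i / (M.factorial : F)) (Sum.inl i))
  · rw [lvGens_inr, exp_div_factorial_eq_pow (c' i) h]
    exact pow_mem (gammaPt_mem_adjoinPt K (fun i => c' i / (M.factorial : F)) (Sum.inr i)) _

/-- Every element of `⟨K c'⟩` lies in `K(c'/M!, exp(c'/M!))` for all large `M`. [folklore] -/
theorem exists_forall_mem_adjoinPt_of_mem_bfld {c' : Fin N → F} {z : F} (hz : z ∈ bfld K c') :
    ∃ M₀ : ℕ, ∀ M, M₀ ≤ M → z ∈ adjoinPt K fun i => c' i / (M.factorial : F) := by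
  classical
  obtain ⟨T, hT, hzT⟩ := IntermediateField.exists_finset_of_mem_adjoin hz
  have hlv : ∀ t : T, ∃ m : ℕ, ∃ j : Fin N ⊕ Fin N, (t : F) = lvGens m c' j := by
    intro t
    have := hT t.2
    simp only [allGens, mem_iUnion, mem_range] at this
    obtain ⟨m, j, hj⟩ := this
    exact ⟨m, j, hj.symm⟩
  choose m j hmj using hlv
  refine ⟨T.attach.sup m, fun M hM => ?_⟩
  have hTsub : (↑T : Set F) ⊆ adjoinPt K fun i => c' i / (M.factorial : F) := by
    intro t ht
    have ht' := hmj ⟨t, ht⟩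
    simp only at ht'
    rw [Finset.mem_coe] at ht
    rw [show t = lvGens (m ⟨t, ht⟩) c' (j ⟨t, ht⟩) from ht']
    exact lvGens_mem_adjoinPt_div_factorial c' ((Finset.le_sup (Finset.mem_attach T ⟨t, ht⟩)).trans hM) _
  have hle : (IntermediateField.adjoin (fieldOf K) (↑T : Set F)).toSubfield ≤
      adjoinPt K fun i => c' i / (M.factorial : F) := by
    rw [IntermediateField.adjoin_toSubfield]
    refine Subfield.closure_le.2 (union_subset ?_ hTsub)
    rintro _ ⟨k, rfl⟩
    exact fieldOf_le_adjoinPt K _ k.2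
  exact hle hzT

/-- **`Z(P')_F` is defined over `K(c'/M!, exp(c'/M!))` for all large `M`**: `P'` is finitely
generated and the finitely many coefficients of a generating set lie in `⟨K c'⟩ = ⋃_M K₀(c', exp(c'/M!))`.
[cite: BaysKirby2018ANT, Def. 11.1 ("`V` is defined over `K(α)`")] -/
theorem exists_forall_isDefinedOver_adjoinPt {c c' : Fin N → F} (hiso : IsGammaIso K c c') (b : Fin n → F) :
    ∃ M₀ : ℕ, ∀ M, M₀ ≤ M → IsDefinedOver (adjoinPt K fun i => c' i / (M.factorial : F))
      (zeroLocus F ((locusIdeal' K hiso b).map (algebraMap (MvPolynomial (Fin n ⊕ Fin n) (bfld K c'))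
        (MvPolynomial (Fin n ⊕ Fin n) F)))) := by
  classical
  obtain ⟨gs, hgs⟩ := (inferInstance : IsNoetherianRing (MvPolynomial (Fin n ⊕ Fin n) (bfld K c'))).noetherian
    (locusIdeal' K hiso b)
  -- a common level for all coefficients
  have hcoef : ∀ z : bfld K c', ∃ M₀ : ℕ, ∀ M, M₀ ≤ M → (z : F) ∈ adjoinPt K fun i => c' i / (M.factorial : F) :=
    fun z => exists_forall_mem_adjoinPt_of_mem_bfld z.2
  choose Mz hMz using hcoef
  refine ⟨gs.sup fun p => p.coeffs.sup Mz, fun M hM => ?_⟩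
  have hmem : ∀ p ∈ gs, ∀ z ∈ p.coeffs, (z : F) ∈ adjoinPt K fun i => c' i / (M.factorial : F) :=
    fun p hp z hz => hMz z M (((Finset.le_sup hz).trans (Finset.le_sup (f := fun p => p.coeffs.sup Mz) hp)).trans hM)
  -- lift the generators
  let j : (adjoinPt K fun i => c' i / (M.factorial : F)) →+* bfld K c' :=
    { toFun := fun x => ⟨x, by
        have hle : (adjoinPt K fun i => c' i / (M.factorial : F)) ≤ (bfld K c').toSubfield := by
          refine Subfield.closure_le.2 (union_subset ?_ ?_)
          · intro y hy; exact (bfld K c').algebraMap_mem ⟨y, hy⟩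
          · rintro _ ⟨r, rfl⟩
            rcases r with i | i
            · exact (div_factorial_mem_bfld c' M i).1
            · exact (div_factorial_mem_bfld c' M i).2
        exact hle x.2⟩
      map_one' := Subtype.ext rfl
      map_mul' := fun _ _ => Subtype.ext rfl
      map_zero' := Subtype.ext rfl
      map_add' := fun _ _ => Subtype.ext rfl }
  have hj : ∀ x, ((j x : bfld K c') : F) = x := fun _ => rfl
  have hlift : ∀ p ∈ gs, ∃ q : MvPolynomial (Fin n ⊕ Fin n) (adjoinPt K fun i => c' i / (M.factorial : F)),
      MvPolynomial.map j q = p := by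
    intro p hp
    change p ∈ Set.range (MvPolynomial.map j)
    rw [MvPolynomial.mem_range_map_iff_coeffs_subset]
    intro z hz
    exact ⟨⟨z, hmem p hp z (Finset.mem_coe.1 hz)⟩, Subtype.ext rfl⟩
  choose q hq using hlift
  refine ⟨Ideal.span (Set.range fun p : gs => q p.1 p.2), ?_⟩
  rw [MvPolynomial.algebraMap_def, Literature.RingTheory.KrullDimension.zeroLocus_map, ← hgs]
  ext x
  rw [zeroLocus_span, zeroLocus_span]
  simp only [Set.mem_setOf_eq, Set.forall_mem_range, Subtype.forall, Finset.mem_coe]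
  refine forall₂_congr fun p hp => ?_
  conv_lhs => rw [← hq p hp, aeval_def, eval₂_map]
  rw [aeval_def]
  rfl

end GammaField

end Literature.NumberTheory.Transcendental
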